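import Summits.QuantumFields.YangMills.Theorems.BalabanUVNodesN07Thm1ScaledInterfaceInstance

/-!
# BalabanUVNodes ∕ N07 ([Balaban1985Variational] Theorem 1 (7)–(8) p. 279, in node00-def-P11's typed readings at the objects of record) —
# THE INTERFACE-PLAQUETTE OBSTRUCTION: the UNGUARDED per-scale named fact `VariationalThm1Scaled F 2 B₃ a₀ a₁` is FALSE for EVERY `B₃` (`0 < a₀`,
# `0 < a₁`), and the same one-step instance pins the numeric side conditions `B₃ ≥ L²` (printed-uniform `VariationalThm1Class`) and `B₃ ≥ 2L²`
# (faithful `VariationalThm1ScaledSep`) in the tree's typing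

HEADLINE.  Work toward ONE FINITE-LATTICE STEP of Bałaban's programme — the typed RANGE of [15] Thm 1 at NODE 00's objects (cell `pub-ymgap`, Track A, DAG
node **N07** = [15] = [Balaban1985Variational]; seat `pub-ymgap-dag-n07-e`, generation 6; `--supports stmt-QuantumFields-19909 --as helper`, the ROW-P11
negative-certificate lane).  THEOREMS ONLY (0 `def`, 0 `sorry`, 0 `instance`).  Reads the companion `…N07Thm1ScaledInterfaceInstance`
(`exists_interface_instance`: one-step index, corner plaquette `p ∈ omegaPlaqs s.Ω 1` pinned to the datum, single-bond datum with `dist1 ≤ dist1 h`,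
the obstruction «(E) ∧ (R) fails whenever `B₃δ₁η₁² ≤ dist1 h`»; `su2_dist1_surj`).  Located target: director-ym LINE №136 ∕ dag-lead WORDS-137
(«`VariationalThm1Scaled`-false — no certificate exists»); node00-def-P11 LOCATED-P11-SEQ (ii), `Record12BgRowAnalysis` §8 docstring «B₃ ≥ L²·δ_n∕δ_{n+1}».

THE ARITHMETIC.  At the corner plaquette the data clause bounds `dist1 (W₀(∂p)) = t` only by `t < δ₀`, the regularity clause at `n = 1` demands
`t < B₃δ₁η₁² = B₃δ₁∕L²`; so (E) ∧ (R) is contradictory as soon as `B₃δ₁∕L² ≤ t < δ₀` is solvable: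
* `VariationalThm1Scaled` (thresholds `δ_n` free): `b := max(B₃,1)`, `δ₀ := min(a₁, a₀∕b, 1)`, `δ₁ := δ₀∕(2b)`, `ε₀ := bδ₀`, `t := δ₀∕2` — EVERY `B₃`
  (`not_variationalThm1Scaled`): the K0‴ chain's hypothesis (node00-def-K0a `Node00.exists_k0_of_thm1Scaled`, which asks `0 < a₀`, `0 < a₁`) is never
  available — option (β) of LOCATED-P11-SEQ could not have been fed; plan g67's (3a)∕v6 re-key to `VariationalThm1ScaledSep` confirmed in numbers;
* `VariationalThm1Class` (uniform `ε₁`): `ε₁ := min(a₁, a₀∕b, 1)`, `t := ε₁(c+1)∕2`, `c := max(B₃,0)∕L² < 1` — every `B₃ < L²` (`not_variationalThm1Class_of_lt`);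
* `VariationalThm1ScaledSep` (separated — vacuous at `k = 1`; comparable `δ₀ ≤ 2δ₁`): `δ₀ := 2ε`, `δ₁ := ε`, `t := 2ε(c+1)∕2`, `c := max(B₃,0)∕(2L²) < 1`
  — every `B₃ < 2L²` (`not_variationalThm1ScaledSep_of_lt`); so the `∃ B₃` of any K0‴ closure through [15] must carry `B₃ ≥ 2(F.L)²` (node00-def-K0a's
  [15]-keyed numerics take `B₃` as a free letter `0 ≤ B₃` — an FYI, not a defect).
General-`SU(N)` forms take `hG : ∀ t ∈ [0, 2], ∃ g : SU N, dist1 g = t`; the `SU(2)` forms discharge it by `su2_dist1_surj`.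

HONEST FRAMING.  Refutes the tree's TYPED READINGS at the tree's objects with the p. 77 «touching» conventions; NOTHING of [15] Theorem 1 AS PRINTED is
refuted or asserted (print's «B₃ depends on d and L only» is compatible — no numeral for `B₃` is printed); the deeper interfaces `Γ_j ∕ Ω_{j+1}`, `j ≥ 1`,
involve the block averaging ([15] Prop. 2) and are NOT touched.  Count-neutral; N07 ∕ K0‴ NOT discharged (typed 28∕28 · discharged 5∕28 unmoved); one
finite `𝕋⁴` programme at fixed `ε = L^{−K}` — NOT continuum ∕ ℝ⁴ ∕ OS ∕ mass gap ∕ Clay.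
-/

noncomputable section

namespace Summit.QuantumFields.YangMills.BalabanUVNodes.N07Thm1ScaledInterfaceObstruction

open Literature.MathematicalPhysics.QuantumFieldTheory.Balaban1983to89
open Literature.MathematicalPhysics.QuantumFieldTheory.Balaban1983to89.T4Continuum (T4Family)
open Literature.MathematicalPhysics.QuantumFieldTheory.Balaban1983to89.Node00
open Literature.MathematicalPhysics.QuantumFieldTheory.Balaban1983to89.B15DeterminingSets
open Summit.QuantumFields.YangMills.BalabanUVNodes.N07Thm1ScaledInterfaceInstance
open scoped Matrix.Norms.L2Operator

/-! ## §1  ★★★ The three refutations (instance: companion `…N07Thm1ScaledInterfaceInstance`) -/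

section Refutations

variable (F : T4Family) {N : ℕ} [NeZero N]

/-- `plaqHol 1 = 1` on any lattice (the flat datum at the scales `j ≥ 1`). [folklore] -/
theorem dist1_plaqHol_one_eq_zero {P : Params} {G : Type*} [GaugeGroup G] {j : ℕ} (q : Plaq P j) :
    dist1 (GaugeField.plaqHol (1 : GaugeField P j G) q) = 0 := by
  have : GaugeField.plaqHol (1 : GaugeField P j G) q = 1 := by
    show (1 : G) * 1 * (1 : G)⁻¹ * (1 : G)⁻¹ = 1
    simp
  rw [this, GaugeGroup.dist1_one]

/-- ★★★ **THE UNGUARDED PER-SCALE READING IS UNINHABITED**: for every `B₃` and all `a₀, a₁ > 0`, `¬ VariationalThm1Scaled F N B₃ a₀ a₁` — on any `SU(N)` whose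
`dist1` takes every value in `[0, 2]`.  Thresholds `δ₀ := min(a₁, a₀∕b, 1)`, `δ₁ := δ₀∕(2b)`, `b := max(B₃, 1)`, `ε₀ := b·δ₀`; datum distance `t = δ₀∕2`:
`B₃δ₁η₁² ≤ δ₀∕2 = t < δ₀`. [cite: Balaban1985Variational, Thm 1 (7)–(8) p.279; Balaban1985RegularSpaces, (1.7) p.77] -/
theorem not_variationalThm1Scaled_of_dist1Surj (hG : ∀ t : ℝ, 0 ≤ t → t ≤ 2 → ∃ g : SU N, dist1 g = t)
    {B₃ a₀ a₁ : ℝ} (ha₀ : 0 < a₀) (ha₁ : 0 < a₁) : ¬ VariationalThm1Scaled F N B₃ a₀ a₁ := by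
  intro h15
  set b : ℝ := max B₃ 1 with hb
  have hb1 : 1 ≤ b := le_max_right _ _
  have hbB : B₃ ≤ b := le_max_left _ _
  have hb0 : 0 < b := by linarith
  set δ₀ : ℝ := min (min a₁ (a₀ / b)) 1 with hδ₀
  have hδ₀pos : 0 < δ₀ := lt_min (lt_min ha₁ (div_pos ha₀ hb0)) one_pos
  have hδ₀a₁ : δ₀ ≤ a₁ := (min_le_left _ _).trans (min_le_left _ _)
  have hδ₀a₀ : δ₀ ≤ a₀ / b := (min_le_left _ _).trans (min_le_right _ _)
  have hδ₀1 : δ₀ ≤ 1 := min_le_right _ _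
  obtain ⟨h, hh⟩ := hG (δ₀ / 2) (by linarith) (by linarith)
  obtain ⟨ν, M, g, s, W, p, -, -, hbd, hW1, hobs⟩ := exists_interface_instance F 1 h
  let δ : ℕ → ℝ := fun n => if n = 0 then δ₀ else δ₀ / (2 * b)
  have hd0 : δ 0 = δ₀ := by simp [δ]
  have hd1 : δ 1 = δ₀ / (2 * b) := by simp [δ]
  have h2b : 0 < 2 * b := by linarith
  have hle : δ₀ / (2 * b) ≤ δ₀ := div_le_self hδ₀pos.le (by linarith)
  have hyp : ∀ n, n ≤ 1 → 0 < δ n ∧ δ n ≤ a₁ ∧ B₃ * δ n ≤ b * δ₀ := by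
    intro n hn
    rcases Nat.le_one_iff_eq_zero_or_eq_one.mp hn with rfl | rfl
    · rw [hd0]
      exact ⟨hδ₀pos, hδ₀a₁, mul_le_mul_of_nonneg_right hbB hδ₀pos.le⟩
    · rw [hd1]
      refine ⟨div_pos hδ₀pos h2b, hle.trans hδ₀a₁, ?_⟩
      calc B₃ * (δ₀ / (2 * b)) ≤ b * (δ₀ / (2 * b)) := mul_le_mul_of_nonneg_right hbB (div_pos hδ₀pos h2b).le
        _ = δ₀ / 2 := by field_simp
        _ ≤ b * δ₀ := by nlinarith
  have hε₀ : b * δ₀ ≤ a₀ := by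
    calc b * δ₀ ≤ b * (a₀ / b) := mul_le_mul_of_nonneg_left hδ₀a₀ hb0.le
      _ = a₀ := by field_simp
  have hW : ∀ n, n ≤ 1 → PlaqSmallOn (B8Eq17ClassAkV1.plaqsOf (genSet s.Ω 1 n)) (δ n) (W n) := by
    intro n hn q _
    rcases Nat.le_one_iff_eq_zero_or_eq_one.mp hn with rfl | rfl
    · rw [hd0]
      exact (hbd q).trans_lt (by rw [hh]; linarith)
    · rw [hd1, hW1 0, dist1_plaqHol_one_eq_zero]
      exact div_pos hδ₀pos h2b
  refine hobs (avOfRecord F N 1) _ ?_ (h15 ν M g 1 1 s (b * δ₀) δ hyp hε₀ W hW)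
  rw [hh, hd1]
  have hη := eta_one_sq_le_one F 1
  have hη0 : 0 ≤ (F.P 1).eta 1 ^ 2 := sq_nonneg _
  have hq : 0 ≤ δ₀ / (2 * b) := (div_pos hδ₀pos h2b).le
  calc B₃ * (δ₀ / (2 * b)) * (F.P 1).eta 1 ^ 2 ≤ b * (δ₀ / (2 * b)) * (F.P 1).eta 1 ^ 2 :=
        mul_le_mul_of_nonneg_right (mul_le_mul_of_nonneg_right hbB hq) hη0
    _ ≤ b * (δ₀ / (2 * b)) * 1 := mul_le_mul_of_nonneg_left hη (mul_nonneg hb0.le hq)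
    _ = δ₀ / 2 := by field_simp

/-- ★★★ **THE PRINTED-UNIFORM READING NEEDS `B₃ ≥ L²`**: for every `B₃ < (F.L)²` and all `a₀, a₁ > 0`, `¬ VariationalThm1Class F N B₃ a₀ a₁` (any `SU(N)` on which
`dist1` takes every value in `[0, 2]`).  Threshold `ε₁ := min(a₁, a₀∕b, 1)`, `ε₀ := b·ε₁`, datum distance `t := ε₁·(c + 1)∕2`, `c := max(B₃,0)∕L² < 1`:
`B₃ε₁η₁² ≤ ε₁c ≤ t < ε₁`. [cite: Balaban1985Variational, Thm 1 (7)–(8) p.279; Balaban1985RegularSpaces, (1.7) p.77] -/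
theorem not_variationalThm1Class_of_lt_of_dist1Surj (hG : ∀ t : ℝ, 0 ≤ t → t ≤ 2 → ∃ g : SU N, dist1 g = t)
    {B₃ a₀ a₁ : ℝ} (ha₀ : 0 < a₀) (ha₁ : 0 < a₁) (hB : B₃ < (F.L : ℝ) ^ 2) : ¬ VariationalThm1Class F N B₃ a₀ a₁ := by
  intro h15
  set b : ℝ := max B₃ 1 with hb
  have hb1 : 1 ≤ b := le_max_right _ _
  have hbB : B₃ ≤ b := le_max_left _ _
  have hb0 : 0 < b := by linarith
  have hL : (0 : ℝ) < (F.L : ℝ) ^ 2 := by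
    have : (1 : ℝ) ≤ F.L := by exact_mod_cast (show 1 ≤ F.L by have := F.hL.2; omega)
    positivity
  set c : ℝ := max B₃ 0 / (F.L : ℝ) ^ 2 with hc
  have hc0 : 0 ≤ c := div_nonneg (le_max_right _ _) hL.le
  have hc1 : c < 1 := (div_lt_one hL).mpr (max_lt hB hL)
  set ε₁ : ℝ := min (min a₁ (a₀ / b)) 1 with hε₁
  have hε₁pos : 0 < ε₁ := lt_min (lt_min ha₁ (div_pos ha₀ hb0)) one_pos
  have hε₁a₁ : ε₁ ≤ a₁ := (min_le_left _ _).trans (min_le_left _ _)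
  have hε₁a₀ : ε₁ ≤ a₀ / b := (min_le_left _ _).trans (min_le_right _ _)
  have hε₁1 : ε₁ ≤ 1 := min_le_right _ _
  have ht1 : ε₁ * ((c + 1) / 2) < ε₁ := by nlinarith
  obtain ⟨h, hh⟩ := hG (ε₁ * ((c + 1) / 2)) (by positivity) (by nlinarith)
  obtain ⟨ν, M, g, s, W, p, -, -, hbd, hW1, hobs⟩ := exists_interface_instance F 1 h
  have hε₀ : b * ε₁ ≤ a₀ := by
    calc b * ε₁ ≤ b * (a₀ / b) := mul_le_mul_of_nonneg_left hε₁a₀ hb0.le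
      _ = a₀ := by field_simp
  have hW : ∀ n, n ≤ 1 → PlaqSmallOn (B8Eq17ClassAkV1.plaqsOf (genSet s.Ω 1 n)) ε₁ (W n) := by
    intro n hn q _
    rcases Nat.le_one_iff_eq_zero_or_eq_one.mp hn with rfl | rfl
    · exact (hbd q).trans_lt (by rw [hh]; exact ht1)
    · rw [hW1 0, dist1_plaqHol_one_eq_zero]
      exact hε₁pos
  refine hobs (avOfRecord F N 1) _ (δ := fun _ => ε₁) ?_
    (h15 ν M g 1 1 s (b * ε₁) ε₁ hε₁pos hε₁a₁ (mul_le_mul_of_nonneg_right hbB hε₁pos.le) hε₀ W hW)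
  rw [hh, eta_one_sq]
  calc B₃ * ε₁ * (1 / (F.L : ℝ) ^ 2) = ε₁ * (B₃ / (F.L : ℝ) ^ 2) := by ring
    _ ≤ ε₁ * c := mul_le_mul_of_nonneg_left (div_le_div_of_nonneg_right (le_max_left _ _) hL.le) hε₁pos.le
    _ ≤ ε₁ * ((c + 1) / 2) := mul_le_mul_of_nonneg_left (by linarith) hε₁pos.le

/-- ★★★ **THE FAITHFUL (SEPARATED, COMPARABLE) READING NEEDS `B₃ ≥ 2L²`**: for every `B₃ < 2(F.L)²` and all `a₀, a₁ > 0`, `¬ VariationalThm1ScaledSep F N B₃ a₀ a₁`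
(any `SU(N)` on which `dist1` takes every value in `[0, 2]`).  The one-step index is separated VACUOUSLY (`k = 1`); thresholds `δ₀ := 2ε`, `δ₁ := ε` (comparable:
`δ₀ ≤ 2δ₁`), `2ε := min(a₁, a₀∕b, 1)`, `ε₀ := b·2ε`; datum distance `t := 2ε·(c + 1)∕2`, `c := max(B₃,0)∕(2L²) < 1`: `B₃εη₁² ≤ 2εc ≤ t < 2ε`.
[cite: Balaban1985Variational, Thm 1 (7)–(8) p.279; Balaban1985RegularSpaces, (1.3)–(1.8) p.77; Balaban1988Convergent, (2.7)–(2.8) pp.255–256] -/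
theorem not_variationalThm1ScaledSep_of_lt_of_dist1Surj (hG : ∀ t : ℝ, 0 ≤ t → t ≤ 2 → ∃ g : SU N, dist1 g = t)
    {B₃ a₀ a₁ : ℝ} (ha₀ : 0 < a₀) (ha₁ : 0 < a₁) (hB : B₃ < 2 * (F.L : ℝ) ^ 2) : ¬ VariationalThm1ScaledSep F N B₃ a₀ a₁ := by
  intro h15
  set b : ℝ := max B₃ 1 with hb
  have hb1 : 1 ≤ b := le_max_right _ _
  have hbB : B₃ ≤ b := le_max_left _ _
  have hb0 : 0 < b := by linarith
  have hL : (0 : ℝ) < 2 * (F.L : ℝ) ^ 2 := by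
    have : (1 : ℝ) ≤ F.L := by exact_mod_cast (show 1 ≤ F.L by have := F.hL.2; omega)
    positivity
  set c : ℝ := max B₃ 0 / (2 * (F.L : ℝ) ^ 2) with hc
  have hc0 : 0 ≤ c := div_nonneg (le_max_right _ _) hL.le
  have hc1 : c < 1 := (div_lt_one hL).mpr (max_lt hB hL)
  -- `e2 = 2ε = δ₀`, `δ₁ = e2 / 2`
  set e2 : ℝ := min (min a₁ (a₀ / b)) 1 with he2
  have he2pos : 0 < e2 := lt_min (lt_min ha₁ (div_pos ha₀ hb0)) one_pos
  have he2a₁ : e2 ≤ a₁ := (min_le_left _ _).trans (min_le_left _ _)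
  have he2a₀ : e2 ≤ a₀ / b := (min_le_left _ _).trans (min_le_right _ _)
  have he21 : e2 ≤ 1 := min_le_right _ _
  have ht1 : e2 * ((c + 1) / 2) < e2 := by nlinarith
  obtain ⟨h, hh⟩ := hG (e2 * ((c + 1) / 2)) (by positivity) (by nlinarith)
  obtain ⟨ν, M, g, s, W, p, hsep, -, hbd, hW1, hobs⟩ := exists_interface_instance F 1 h
  let δ : ℕ → ℝ := fun n => if n = 0 then e2 else e2 / 2
  have hd0 : δ 0 = e2 := by simp [δ]
  have hd1 : δ 1 = e2 / 2 := by simp [δ]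
  have hyp : ∀ n, n ≤ 1 → 0 < δ n ∧ δ n ≤ a₁ ∧ B₃ * δ n ≤ b * e2 := by
    intro n hn
    rcases Nat.le_one_iff_eq_zero_or_eq_one.mp hn with rfl | rfl
    · rw [hd0]
      exact ⟨he2pos, he2a₁, mul_le_mul_of_nonneg_right hbB he2pos.le⟩
    · rw [hd1]
      refine ⟨by linarith, by linarith, ?_⟩
      calc B₃ * (e2 / 2) ≤ b * (e2 / 2) := mul_le_mul_of_nonneg_right hbB (by linarith)
        _ ≤ b * e2 := by nlinarith
  have hcomp : ∀ n, n < 1 → δ n ≤ 2 * δ (n + 1) := by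
    intro n hn
    obtain rfl : n = 0 := by omega
    rw [hd0, hd1]
    linarith
  have hε₀ : b * e2 ≤ a₀ := by
    calc b * e2 ≤ b * (a₀ / b) := mul_le_mul_of_nonneg_left he2a₀ hb0.le
      _ = a₀ := by field_simp
  have hW : ∀ n, n ≤ 1 → PlaqSmallOn (B8Eq17ClassAkV1.plaqsOf (genSet s.Ω 1 n)) (δ n) (W n) := by
    intro n hn q _
    rcases Nat.le_one_iff_eq_zero_or_eq_one.mp hn with rfl | rfl
    · rw [hd0]
      exact (hbd q).trans_lt (by rw [hh]; exact ht1)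
    · rw [hd1, hW1 0, dist1_plaqHol_one_eq_zero]
      linarith
  refine hobs (avOfRecord F N 1) _ ?_ (h15 ν M g 1 1 s hsep (b * e2) δ hyp hcomp hε₀ W hW)
  rw [hh, hd1, eta_one_sq]
  calc B₃ * (e2 / 2) * (1 / (F.L : ℝ) ^ 2) = e2 * (B₃ / (2 * (F.L : ℝ) ^ 2)) := by ring
    _ ≤ e2 * c := mul_le_mul_of_nonneg_left (div_le_div_of_nonneg_right (le_max_left _ _) hL.le) he2pos.le
    _ ≤ e2 * ((c + 1) / 2) := mul_le_mul_of_nonneg_left (by linarith) he2pos.le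

/-- ★★★ **`SU(2)`: THE UNGUARDED PER-SCALE NAMED FACT IS FALSE FOR EVERY `B₃`** (`0 < a₀`, `0 < a₁`) — the K0‴ chain's hypothesis
`VariationalThm1Scaled F 2 B₃ a₀ a₁` (node00-def-K0a `Node00.exists_k0_of_thm1Scaled`, which asks `0 < a₀`, `0 < a₁`) is never available.
[cite: Balaban1985Variational, Thm 1 (7)–(8) p.279; Balaban1985RegularSpaces, (1.7) p.77] -/
theorem not_variationalThm1Scaled {B₃ a₀ a₁ : ℝ} (ha₀ : 0 < a₀) (ha₁ : 0 < a₁) : ¬ VariationalThm1Scaled F 2 B₃ a₀ a₁ :=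
  not_variationalThm1Scaled_of_dist1Surj F su2_dist1_surj ha₀ ha₁

/-- ★★★ **`SU(2)`: the printed-uniform reading is false for every `B₃ < L²`.** [cite: Balaban1985Variational, Thm 1 (7)–(8) p.279; Balaban1985RegularSpaces, (1.7) p.77] -/
theorem not_variationalThm1Class_of_lt {B₃ a₀ a₁ : ℝ} (ha₀ : 0 < a₀) (ha₁ : 0 < a₁) (hB : B₃ < (F.L : ℝ) ^ 2) :
    ¬ VariationalThm1Class F 2 B₃ a₀ a₁ :=
  not_variationalThm1Class_of_lt_of_dist1Surj F su2_dist1_surj ha₀ ha₁ hB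

/-- ★★★ **`SU(2)`: the faithful (separated, comparable) reading is false for every `B₃ < 2L²`** — the `∃ B₃` of a K0‴ closure through [15] must carry `B₃ ≥ 2(F.L)²`.
[cite: Balaban1985Variational, Thm 1 (7)–(8) p.279; Balaban1985RegularSpaces, (1.3)–(1.8) p.77] -/
theorem not_variationalThm1ScaledSep_of_lt {B₃ a₀ a₁ : ℝ} (ha₀ : 0 < a₀) (ha₁ : 0 < a₁) (hB : B₃ < 2 * (F.L : ℝ) ^ 2) :
    ¬ VariationalThm1ScaledSep F 2 B₃ a₀ a₁ :=
  not_variationalThm1ScaledSep_of_lt_of_dist1Surj F su2_dist1_surj ha₀ ha₁ hB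

/-- Contrapositive packaging for the K0‴ lane: if the unguarded named fact holds at `SU(2)` for some `(B₃, a₀, a₁)` then `a₀ ≤ 0` or `a₁ ≤ 0` — a regime in which its
own hypotheses `0 < δ_n ≤ a₁`, `B₃δ_n ≤ ε₀ ≤ a₀` are unsatisfiable (for `B₃ > 0`), i.e. the fact is then VACUOUS. [cite: Balaban1985Variational, Thm 1 (7)–(8) p.279 (bookkeeping)] -/
theorem variationalThm1Scaled_only_degenerate {B₃ a₀ a₁ : ℝ} (h : VariationalThm1Scaled F 2 B₃ a₀ a₁) : a₀ ≤ 0 ∨ a₁ ≤ 0 := by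
  by_contra hc
  simp only [not_or, not_le] at hc
  exact not_variationalThm1Scaled F hc.1 hc.2 h

end Refutations

end Summit.QuantumFields.YangMills.BalabanUVNodes.N07Thm1ScaledInterfaceObstruction

end
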